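import Mathlib
import Summits.AtomisticToContinuum.BoseEinsteinCondensation.Theorems.SoloBlindSectorGapMoment

/-!
# The abstract susceptibility (negative-moment) inequality

Solo line II, door 3 ("Gaussian domination ⟹ BEC"; paper §12): the zero-temperature form of the
Dyson–Lieb–Simon / Kennedy–Lieb–Shastry transfer from an *infrared (susceptibility) bound* to an
occupation bound, in the same abstract setting as `SoloBlindSectorGapMoment`.

For a positive symmetric linear map `P` (think `P = Π (H - e ∓ μ) Π`, the Hamiltonian minus a
shifted ground-state energy on a momentum sector of `N ± 1` particles) the three "moments" of a
vector `y = P z` are `m₁ = re ⟪y, P y⟫`, `m₀ = ‖y‖²`, `m₋₁ = re ⟪z, y⟫ = re ⟪z, P z⟫`, and the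
Cauchy–Schwarz inequality for the form of `P` gives `m₀² ≤ m₁ · m₋₁`
(`norm_sq_sq_le_moment_mul`). The two-sided version (`twoSided_norm_sq_sq_le`) adds the
`N + 1` and `N - 1` sides before squaring, and `occupation_susceptibility_bound` rewrites `m₁` through
the double-commutator identity of `SoloBlindSectorGapMoment`: with `H Ψ = e Ψ`, formal adjoints `A`, `B` (`a_k`, `a_k†`) and the commutation
relation `‖BΨ‖² = ‖AΨ‖² + c`,

  `(‖AΨ‖² + ‖BΨ‖²)² ≤ (re ⟪Ψ,[A,[H,B]]Ψ⟫ - μ c) · (re ⟪z₊, BΨ⟫ + re ⟪z₋, AΨ⟫)`,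

i.e. `(2 n_k + 1)² ≤ (ε̃_k - μ) · χ_k(μ)` where `χ_k(μ)` is the two-sided one-particle susceptibility.
An upper bound `χ_k(μ) ≤ C/ε_k` (zero-temperature Gaussian domination) therefore bounds `n_k` by
`O(√(ρ‖v‖₁)/|k|)` on the phonon window — the infrared bound fed to Theorem K.
No analysis enters.
-/

namespace Summit.AtomisticToContinuum.BoseEinsteinCondensation.Theorems

open scoped InnerProductSpace ComplexConjugate

variable {E : Type*} [NormedAddCommGroup E] [InnerProductSpace ℂ E]

/-- Cauchy–Schwarz for the (possibly degenerate) form of a positive symmetric linear map: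
`(re ⟪z, P y⟫)² ≤ re ⟪z, P z⟫ · re ⟪y, P y⟫`. -/
theorem re_inner_sq_le_of_nonneg (P : E →ₗ[ℂ] E) (hP : P.IsSymmetric)
    (hpos : ∀ x : E, 0 ≤ (⟪x, P x⟫_ℂ).re) (z y : E) :
    (⟪z, P y⟫_ℂ).re ^ 2 ≤ (⟪z, P z⟫_ℂ).re * (⟪y, P y⟫_ℂ).re := by
  -- the quadratic `t ↦ re ⟪z + t y, P (z + t y)⟫` is nonnegative
  have hyz : (⟪y, P z⟫_ℂ).re = (⟪z, P y⟫_ℂ).re := by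
    rw [← hP y z, ← inner_conj_symm z (P y), Complex.conj_re]
  have hq : ∀ t : ℝ,
      0 ≤ (⟪y, P y⟫_ℂ).re * (t * t) + 2 * (⟪z, P y⟫_ℂ).re * t + (⟪z, P z⟫_ℂ).re := by
    intro t
    have h0 := hpos (z + (t : ℂ) • y)
    have hexp : (⟪z + (t : ℂ) • y, P (z + (t : ℂ) • y)⟫_ℂ).re
        = (⟪z, P z⟫_ℂ).re + t * (⟪z, P y⟫_ℂ).re + t * (⟪y, P z⟫_ℂ).re
          + t * t * (⟪y, P y⟫_ℂ).re := by
      simp only [map_add, map_smul, inner_add_left, inner_add_right, inner_smul_left,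
        inner_smul_right, Complex.conj_ofReal, Complex.add_re, Complex.mul_re,
        Complex.ofReal_re, Complex.ofReal_im, zero_mul, sub_zero]
      ring
    rw [hexp, hyz] at h0
    nlinarith [h0]
  have hd := discrim_le_zero hq
  rw [discrim] at hd
  nlinarith [hd]

/-- **One-sided moment inequality** `m₀² ≤ m₁ m₋₁`: for a positive symmetric `P` and `y = P z`,
`‖y‖⁴ ≤ re ⟪y, P y⟫ · re ⟪z, y⟫` (and `re ⟪z, y⟫ = re ⟪z, P z⟫` is the "susceptibility"
`⟪y, P⁻¹ y⟫`). -/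
theorem norm_sq_sq_le_moment_mul (P : E →ₗ[ℂ] E) (hP : P.IsSymmetric)
    (hpos : ∀ x : E, 0 ≤ (⟪x, P x⟫_ℂ).re) {y z : E} (hyz : P z = y) :
    (‖y‖ ^ 2) ^ 2 ≤ (⟪y, P y⟫_ℂ).re * (⟪z, y⟫_ℂ).re := by
  have h1 : ‖y‖ ^ 2 = (⟪z, P y⟫_ℂ).re := by
    rw [← hP z y, hyz, inner_self_eq_norm_sq_to_K]
    norm_cast
  have h2 : (⟪z, P z⟫_ℂ).re = (⟪z, y⟫_ℂ).re := by rw [hyz]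
  rw [h1, ← h2, mul_comm]
  exact re_inner_sq_le_of_nonneg P hP hpos z y

/-- Elementary: `a² ≤ b c`, `a'² ≤ b' c'` with everything nonnegative give
`(a + a')² ≤ (b + b') (c + c')` (Cauchy–Schwarz in `ℝ²`). -/
theorem add_sq_le_add_mul_add {a a' b c b' c' : ℝ} (ha : 0 ≤ a) (ha' : 0 ≤ a')
    (hb : 0 ≤ b) (hc : 0 ≤ c) (hb' : 0 ≤ b') (hc' : 0 ≤ c')
    (h : a ^ 2 ≤ b * c) (h' : a' ^ 2 ≤ b' * c') :
    (a + a') ^ 2 ≤ (b + b') * (c + c') := by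
  -- `2 a a' ≤ b c' + b' c` because `(2 a a')² ≤ 4 (b c) (b' c') ≤ (b c' + b' c)²`
  have hcross : 2 * a * a' ≤ b * c' + b' * c := by
    have hsq : (2 * a * a') ^ 2 ≤ (b * c' + b' * c) ^ 2 := by
      have e1 : (2 * a * a') ^ 2 = 4 * a ^ 2 * a' ^ 2 := by ring
      have e2 : 4 * (b * c) * (b' * c') ≤ (b * c' + b' * c) ^ 2 := by
        nlinarith [sq_nonneg (b * c' - b' * c)]
      have e3 : 4 * a ^ 2 * a' ^ 2 ≤ 4 * (b * c) * (b' * c') := by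
        have := mul_le_mul h h' (sq_nonneg a') (mul_nonneg hb hc)
        nlinarith [this]
      rw [e1]
      exact e3.trans e2
    have hnn : 0 ≤ b * c' + b' * c := by positivity
    have h2aa : 0 ≤ 2 * a * a' := by positivity
    nlinarith [hsq, hnn, h2aa, mul_nonneg hnn h2aa]
  nlinarith [hcross, h, h']

/-- **Two-sided moment inequality.** For positive symmetric `P₊`, `P₋` and `y₊ = P₊ z₊`,
`y₋ = P₋ z₋`: `(‖y₊‖² + ‖y₋‖²)² ≤ (re⟪y₊,P₊y₊⟫ + re⟪y₋,P₋y₋⟫) · (re⟪z₊,y₊⟫ + re⟪z₋,y₋⟫)`. -/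
theorem twoSided_norm_sq_sq_le (Pp Pm : E →ₗ[ℂ] E) (hPp : Pp.IsSymmetric) (hPm : Pm.IsSymmetric)
    (hposp : ∀ x : E, 0 ≤ (⟪x, Pp x⟫_ℂ).re) (hposm : ∀ x : E, 0 ≤ (⟪x, Pm x⟫_ℂ).re)
    {yp zp ym zm : E} (hp : Pp zp = yp) (hm : Pm zm = ym) :
    (‖yp‖ ^ 2 + ‖ym‖ ^ 2) ^ 2 ≤
      ((⟪yp, Pp yp⟫_ℂ).re + (⟪ym, Pm ym⟫_ℂ).re) * ((⟪zp, yp⟫_ℂ).re + (⟪zm, ym⟫_ℂ).re) := by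
  have h1 := norm_sq_sq_le_moment_mul Pp hPp hposp hp
  have h2 := norm_sq_sq_le_moment_mul Pm hPm hposm hm
  have hzp : 0 ≤ (⟪zp, yp⟫_ℂ).re := by rw [← hp]; exact hposp zp
  have hzm : 0 ≤ (⟪zm, ym⟫_ℂ).re := by rw [← hm]; exact hposm zm
  exact add_sq_le_add_mul_add (sq_nonneg _) (sq_nonneg _) (hposp yp) hzp (hposm ym) hzm h1 h2

/-- Real part of the double-commutator identity `inner_doubleCommutator_eq` of
`SoloBlindSectorGapMoment`:
`re ⟪Ψ, (A H B - A B H - H B A + B H A) Ψ⟫ = (re⟪BΨ, H BΨ⟫ - e‖BΨ‖²) + (re⟪AΨ, H AΨ⟫ - e‖AΨ‖²)`. -/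
theorem re_inner_doubleCommutator_eq (H A B : E →ₗ[ℂ] E) (hH : H.IsSymmetric)
    (hAB : ∀ x y : E, ⟪A x, y⟫_ℂ = ⟪x, B y⟫_ℂ) {Ψ : E} {e : ℝ} (hΨ : H Ψ = (e : ℂ) • Ψ) :
    (⟪Ψ, A (H (B Ψ)) - A (B (H Ψ)) - H (B (A Ψ)) + B (H (A Ψ))⟫_ℂ).re
      = ((⟪B Ψ, H (B Ψ)⟫_ℂ).re - e * ‖B Ψ‖ ^ 2)
        + ((⟪A Ψ, H (A Ψ)⟫_ℂ).re - e * ‖A Ψ‖ ^ 2) := by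
  have r1 : ((e : ℂ) * (‖B Ψ‖ : ℂ) ^ 2).re = e * ‖B Ψ‖ ^ 2 := by
    rw [← Complex.ofReal_pow, ← Complex.ofReal_mul, Complex.ofReal_re]
  have r2 : ((e : ℂ) * (‖A Ψ‖ : ℂ) ^ 2).re = e * ‖A Ψ‖ ^ 2 := by
    rw [← Complex.ofReal_pow, ← Complex.ofReal_mul, Complex.ofReal_re]
  rw [inner_doubleCommutator_eq H A B hH hAB hΨ]
  simp only [Complex.add_re, Complex.sub_re, r1, r2]

/-- **Occupation–susceptibility bound** (paper §12, inequality (♣), abstract form).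
Let `H` be symmetric with eigenvector `H Ψ = e Ψ`, `A`, `B` formal adjoints with
`‖BΨ‖² = ‖AΨ‖² + c` (`[a_k, a_k†] = 1`, `c = ‖Ψ‖²`). Let `P₊`, `P₋` be positive symmetric maps whose
forms agree at `BΨ`, `AΨ` with those of `H - (e + μ)` and `H - (e - μ)` respectively (in the
application: the sector restrictions of `H_{N+1} - E_N - μ` and `H_{N-1} - E_N + μ`), and let
`P₊ z₊ = BΨ`, `P₋ z₋ = AΨ` (so `re⟪z₊,BΨ⟫ + re⟪z₋,AΨ⟫` is the two-sided susceptibility `χ(μ)`).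
Then `(‖AΨ‖² + ‖BΨ‖²)² ≤ (re ⟪Ψ,[A,[H,B]]Ψ⟫ - μ c) · χ(μ)`, i.e. `(2n_k+1)² ≤ (ε̃_k - μ) χ_k(μ)`. -/
theorem occupation_susceptibility_bound (H A B Pp Pm : E →ₗ[ℂ] E) (hH : H.IsSymmetric)
    (hAB : ∀ x y : E, ⟪A x, y⟫_ℂ = ⟪x, B y⟫_ℂ) {Ψ : E} {e μ c : ℝ} (hΨ : H Ψ = (e : ℂ) • Ψ)
    (hCCR : ‖B Ψ‖ ^ 2 = ‖A Ψ‖ ^ 2 + c)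
    (hPp : Pp.IsSymmetric) (hPm : Pm.IsSymmetric)
    (hposp : ∀ x : E, 0 ≤ (⟪x, Pp x⟫_ℂ).re) (hposm : ∀ x : E, 0 ≤ (⟪x, Pm x⟫_ℂ).re)
    (hformp : (⟪B Ψ, Pp (B Ψ)⟫_ℂ).re = (⟪B Ψ, H (B Ψ)⟫_ℂ).re - (e + μ) * ‖B Ψ‖ ^ 2)
    (hformm : (⟪A Ψ, Pm (A Ψ)⟫_ℂ).re = (⟪A Ψ, H (A Ψ)⟫_ℂ).re - (e - μ) * ‖A Ψ‖ ^ 2)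
    {zp zm : E} (hzp : Pp zp = B Ψ) (hzm : Pm zm = A Ψ) :
    (‖A Ψ‖ ^ 2 + ‖B Ψ‖ ^ 2) ^ 2 ≤
      ((⟪Ψ, A (H (B Ψ)) - A (B (H Ψ)) - H (B (A Ψ)) + B (H (A Ψ))⟫_ℂ).re - μ * c)
        * ((⟪zp, B Ψ⟫_ℂ).re + (⟪zm, A Ψ⟫_ℂ).re) := by
  have h := twoSided_norm_sq_sq_le Pp Pm hPp hPm hposp hposm hzp hzm
  have hm1 : (⟪B Ψ, Pp (B Ψ)⟫_ℂ).re + (⟪A Ψ, Pm (A Ψ)⟫_ℂ).re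
      = (⟪Ψ, A (H (B Ψ)) - A (B (H Ψ)) - H (B (A Ψ)) + B (H (A Ψ))⟫_ℂ).re - μ * c := by
    rw [re_inner_doubleCommutator_eq H A B hH hAB hΨ, hformp, hformm, hCCR]
    ring
  rw [add_comm (‖A Ψ‖ ^ 2), ← hm1]
  exact h

/-- **Infrared bound from Gaussian domination** (the numerical consequence used in Theorem G):
if `(2n+1)² ≤ m · χ` with `m ≤ ε + s` (`s = 3ρ‖v‖₁`, say) and the susceptibility bound
`χ ≤ C/ε` (`ε = k² > 0`, `C, s ≥ 0`), then `2n + 1 ≤ √C · (1 + √s/√ε)`, i.e.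
`n_k ≤ (√C - 1)/2 + √C √s /(2|k|)` (no sign assumption on `n` is needed). -/
theorem two_mul_add_one_le_of_susceptibility {n m χ ε s C : ℝ}
    (hε : 0 < ε) (hs : 0 ≤ s) (hC : 0 ≤ C) (hχ : 0 ≤ χ)
    (h : (2 * n + 1) ^ 2 ≤ m * χ) (hm : m ≤ ε + s) (hχC : χ ≤ C / ε) :
    2 * n + 1 ≤ Real.sqrt C * (1 + Real.sqrt s / Real.sqrt ε) := by
  have hmχ : m * χ ≤ (ε + s) * (C / ε) := by
    rcases eq_or_lt_of_le hχ with hχ0 | hχpos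
    · rw [← hχ0, mul_zero]; positivity
    · exact (mul_le_mul_of_nonneg_right hm hχ).trans
        (mul_le_mul_of_nonneg_left hχC (by linarith))
  have hsq : (2 * n + 1) ^ 2 ≤ (Real.sqrt C * (1 + Real.sqrt s / Real.sqrt ε)) ^ 2 := by
    have key : (Real.sqrt C * (1 + Real.sqrt s / Real.sqrt ε)) ^ 2
        = C * (1 + s / ε + 2 * (Real.sqrt s / Real.sqrt ε)) := by
      rw [mul_pow, Real.sq_sqrt hC, add_sq, div_pow, Real.sq_sqrt hs, Real.sq_sqrt hε.le]
      ring
    rw [key]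
    have hCε : (ε + s) * (C / ε) = C * (1 + s / ε) := by
      have hne := hε.ne'
      calc (ε + s) * (C / ε) = C * ((ε + s) / ε) := by ring
        _ = C * (1 + s / ε) := by rw [add_div, div_self hne]
    have hx : 0 ≤ 2 * (Real.sqrt s / Real.sqrt ε) := by positivity
    calc (2 * n + 1) ^ 2 ≤ m * χ := h
      _ ≤ C * (1 + s / ε) := by rw [← hCε]; exact hmχ
      _ ≤ C * (1 + s / ε + 2 * (Real.sqrt s / Real.sqrt ε)) := by
          apply mul_le_mul_of_nonneg_left _ hC; linarith
  have hR : 0 ≤ Real.sqrt C * (1 + Real.sqrt s / Real.sqrt ε) := by positivity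
  nlinarith [hsq, hR]

end Summit.AtomisticToContinuum.BoseEinsteinCondensation.Theorems
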